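import Summits.QuantumFields.YangMills.Theorems.ColdStartUniversalityShenZhuZhuTalagrandSU2
import Summits.QuantumFields.YangMills.Theorems.ColdStartUniversalityLatticeLangevinEntropicTVMixingSU2
import HarnessLib

/-!
# OTTO–VILLANI, packaged: a local-majorant log-Sobolev inequality `LSI(C)` on a compact metric probability space gives `T₂(C)`; `W₁ ≤ W₂`;
# and `T₁` for the `SU(2)` Wilson–Gibbs measure: `W₁^{ρ_L}(ν, μ_(β'))² ≤ (2/(1−12|β'|))·KL(ν‖μ_(β'))`

Seat `ym-line-csu-p1` (g42), route `ColdStartUniversality` of `Summits/QuantumFields/YangMills`, helper file G75 (`--supports stmt-QuantumFields-24809`).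
API hygiene for the generic chain G69a–d (one theorem `LSI ⇒ T₂` instead of two halves), the elementary comparison `W₁² ≤ W₂²` of the tree's
coupling infima (`szzWassersteinSq` with costs `√c` and `c`, Cauchy–Schwarz), and the resulting `T₁` inequality for the Wilson–Gibbs law.

* ★★★ `szzWassersteinSq_le_klDiv_of_logSobolev` — GENERIC Otto–Villani theorem: `LSI(C)` with local Lipschitz majorants ⇒ `W₂(ν,μ)² ≤ 2C·KL(ν‖μ)`;
* ★★ `szzWassersteinSq_sqrt_sq_le` — GENERIC: `(inf_π ∫√c dπ)² ≤ inf_π ∫c dπ` for measurable `c ≥ 0`;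
* ★★★ `wilson_talagrand_T1` — `(szzWassersteinSq ρ_L ν μ_(β'))² ≤ ofReal((2/(1−12|β'|))·KL(ν‖μ_(β')))`, every probability `ν` with finite entropy, every `L`.

THEOREMS ONLY, no definition, no sorry.  HONEST FRAMING: §1–§2 are abstract; §3 is fixed cut-off, finite volume, `|β'| < 1/12`; nothing `K`-uniform;
`UniformColdStartMixing` (24809, ASIDE) is not restated; no crux, rung or summit statement is proved; the Yang–Mills mass gap is NOT proved.
-/

set_option autoImplicit false

noncomputable section

namespace Summit.QuantumFields.YangMills.Theorems.ColdStartUniversality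

open MeasureTheory ProbabilityTheory Filter Topology Set Metric InformationTheory
open scoped BigOperators NNReal ENNReal
open Literature.Geometry.Riemannian (IsCoupling)

/-! ## §1. `LSI(C) ⇒ T₂(C)` (generic) -/

section Generic

variable {X : Type*} [MetricSpace X] [CompactSpace X] [MeasurableSpace X] [BorelSpace X]

/-- ★★★ **Otto–Villani.**  On a compact metric space with a Borel probability measure `μ`, a log-Sobolev inequality with constant `C > 0` for
Lipschitz exponentials with local (ball-wise, upper semicontinuous) Lipschitz majorants implies Talagrand's transport inequality
`W₂(ν, μ)² ≤ 2C·KL(ν‖μ)` for every probability `ν` of finite relative entropy (Hopf–Lax hypercontractivity G69a–c + duality G69d).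
[cite: BakryGentilLedoux2014, Thm 9.6.1] -/
theorem szzWassersteinSq_le_klDiv_of_logSobolev (μ : Measure X) [IsProbabilityMeasure μ] {C : ℝ} (hC : 0 < C)
    (hLS : ∀ (F : X → ℝ) (Lf : ℝ), 0 ≤ Lf → (∀ z z' : X, |F z' - F z| ≤ Lf * dist z z') → ∀ (R : ℝ), 0 < R →
      ∀ (G : X → ℝ) (M : ℝ), UpperSemicontinuous G → (∀ w, 0 ≤ G w) → (∀ w, G w ≤ M) →
      (∀ w z' z'' : X, dist w z' ≤ R → dist w z'' ≤ R → |F z'' - F z'| ≤ G w * dist z' z'') →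
      ∫ x, F x * Real.exp (F x) ∂μ - (∫ x, Real.exp (F x) ∂μ) * Real.log (∫ x, Real.exp (F x) ∂μ) ≤ C / 2 * ∫ x, G x ^ 2 * Real.exp (F x) ∂μ)
    (ν : Measure X) [IsProbabilityMeasure ν] (hfin : klDiv ν μ ≠ ∞) :
    Literature.MathematicalPhysics.QuantumFieldTheory.szzWassersteinSq (fun x y : X => dist x y ^ 2) ν μ ≤ ENNReal.ofReal (2 * C * (klDiv ν μ).toReal) :=
  szzWassersteinSq_le_klDiv_of_dual μ hC (fun _ _ hf hLf hlip => integral_exp_hopfLax_le μ hC hLS hf hLf hlip) ν hfin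

end Generic

/-! ## §2. `W₁ ≤ W₂` (generic) -/

/-- ★★ **`W₁² ≤ W₂²` for the tree's coupling infima.**  For a measurable cost `c ≥ 0` and any two measures `ν, μ`:
`(inf_π ∫ √c dπ)² ≤ inf_π ∫ c dπ`, the infima over couplings `π` of `(ν, μ)` (probability measures), by Cauchy–Schwarz. [folklore] -/
theorem szzWassersteinSq_sqrt_sq_le {Y : Type*} [MeasurableSpace Y] (c : Y → Y → ℝ) (hcm : Measurable fun z : Y × Y => c z.1 z.2)
    (hc0 : ∀ x y, 0 ≤ c x y) (ν μ : Measure Y) :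
    Literature.MathematicalPhysics.QuantumFieldTheory.szzWassersteinSq (fun x y => Real.sqrt (c x y)) ν μ ^ 2 ≤
      Literature.MathematicalPhysics.QuantumFieldTheory.szzWassersteinSq c ν μ := by
  refine le_iInf fun q => ?_
  obtain ⟨cpl, hπ⟩ := q
  haveI : IsProbabilityMeasure cpl := hπ.1
  have hW1 : Literature.MathematicalPhysics.QuantumFieldTheory.szzWassersteinSq (fun x y => Real.sqrt (c x y)) ν μ ≤
      ∫⁻ z, ENNReal.ofReal (Real.sqrt (c z.1 z.2)) ∂cpl :=
    Literature.MathematicalPhysics.QuantumFieldTheory.szzWassersteinSq_le _ hπ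
  show _ ≤ ∫⁻ z, ENNReal.ofReal (c z.1 z.2) ∂cpl
  by_cases hinf : ∫⁻ z, ENNReal.ofReal (c z.1 z.2) ∂cpl = ∞
  · rw [hinf]; exact le_top
  -- `c` is integrable, hence so is `√c ≤ 1 + c`
  have hci : Integrable (fun z : Y × Y => c z.1 z.2) cpl :=
    ⟨hcm.aestronglyMeasurable, (hasFiniteIntegral_iff_ofReal (ae_of_all _ fun z : Y × Y => hc0 z.1 z.2)).2 (lt_top_iff_ne_top.2 hinf)⟩
  have hsm : Measurable fun z : Y × Y => Real.sqrt (c z.1 z.2) := Real.continuous_sqrt.measurable.comp hcm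
  have hsi : Integrable (fun z : Y × Y => Real.sqrt (c z.1 z.2)) cpl := by
    have h1c : Integrable (fun z : Y × Y => 1 + c z.1 z.2) cpl := (integrable_const (1 : ℝ)).add hci
    refine Integrable.mono' h1c hsm.aestronglyMeasurable (ae_of_all _ fun z => ?_)
    rw [Real.norm_eq_abs, abs_of_nonneg (Real.sqrt_nonneg _)]
    have h := hc0 z.1 z.2
    nlinarith [Real.sq_sqrt h, Real.sqrt_nonneg (c z.1 z.2)]
  have hs2 : Integrable (fun z : Y × Y => Real.sqrt (c z.1 z.2) ^ 2) cpl := by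
    refine hci.congr (ae_of_all _ fun z => ?_)
    exact (Real.sq_sqrt (hc0 z.1 z.2)).symm
  have hCS := sq_integral_le_integral_sq cpl hsi hs2
  have hsq : ∫ z, Real.sqrt (c z.1 z.2) ^ 2 ∂cpl = ∫ z, c z.1 z.2 ∂cpl := integral_congr_ae (ae_of_all _ fun z => Real.sq_sqrt (hc0 z.1 z.2))
  rw [hsq] at hCS
  have e1 : ∫⁻ z, ENNReal.ofReal (Real.sqrt (c z.1 z.2)) ∂cpl = ENNReal.ofReal (∫ z, Real.sqrt (c z.1 z.2) ∂cpl) :=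
    (ofReal_integral_eq_lintegral_ofReal hsi (ae_of_all _ fun z => Real.sqrt_nonneg _)).symm
  have e2 : ∫⁻ z, ENNReal.ofReal (c z.1 z.2) ∂cpl = ENNReal.ofReal (∫ z, c z.1 z.2 ∂cpl) :=
    (ofReal_integral_eq_lintegral_ofReal hci (ae_of_all _ fun z => hc0 z.1 z.2)).symm
  rw [e1] at hW1
  rw [e2]
  calc Literature.MathematicalPhysics.QuantumFieldTheory.szzWassersteinSq (fun x y => Real.sqrt (c x y)) ν μ ^ 2
      ≤ ENNReal.ofReal (∫ z, Real.sqrt (c z.1 z.2) ∂cpl) ^ 2 := pow_le_pow_left' hW1 2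
    _ = ENNReal.ofReal ((∫ z, Real.sqrt (c z.1 z.2) ∂cpl) ^ 2) := (ENNReal.ofReal_pow (integral_nonneg fun z => Real.sqrt_nonneg _) 2).symm
    _ ≤ ENNReal.ofReal (∫ z, c z.1 z.2 ∂cpl) := ENNReal.ofReal_le_ofReal hCS

/-! ## §3. `T₁` for the Wilson–Gibbs measure -/

open Literature.Probability.Process Literature.MathematicalPhysics.QuantumFieldTheory
open Literature.MathematicalPhysics.QuantumLattice (fundamentalRep fundamentalLatticeRep continuous_fundamentalRep fundamentalRep_apply fundamentalLatticeRep_N)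

/-- ★★★ **Talagrand's `T₁` for the `SU(2)` Wilson–Gibbs measure, uniformly in the volume.**  For `|β'| < 1/12`, every `L` and every probability
`ν` with `KL(ν‖μ_(β')) < ∞`:  `(szzWassersteinSq ρ_L ν μ_(β'))² ≤ ofReal((2/(1−12|β'|))·KL(ν‖μ_(β')))`, i.e.
`W₁^{ρ_L}(ν, μ_(β')) ≤ √((2/(1−12|β'|))·KL(ν‖μ_(β')))` with the tree's `W₁ = inf_π ∫ρ_L dπ` (G70b and `W₁ ≤ W₂`). [cite: BakryGentilLedoux2014, Thm 9.6.1] -/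
theorem wilson_talagrand_T1 (L : ℕ) [NeZero L] (β' : ℝ) (hβ : |β'| < 1 / 12)
    (ν : Measure (GaugeConfig 3 L (Matrix.specialUnitaryGroup (Fin 2) ℂ))) [IsProbabilityMeasure ν]
    (hfin : klDiv ν (wilsonMeasure (d := 3) (L := L) (fundamentalRep (Fin 2)) β') ≠ ∞) :
    szzWassersteinSq (fun x y => Real.sqrt (torusRiemannDistSq (fundamentalLatticeRep 2) x y)) ν (wilsonMeasure (d := 3) (L := L) (fundamentalRep (Fin 2)) β') ^ 2 ≤
      ENNReal.ofReal (2 * (1 / (1 - 12 * |β'|)) * (klDiv ν (wilsonMeasure (d := 3) (L := L) (fundamentalRep (Fin 2)) β')).toReal) := by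
  classical
  haveI := secondCountableTopology_su2
  haveI := borelSpace_config L
  have hnn : ∀ u v : GaugeConfig 3 L (Matrix.specialUnitaryGroup (Fin 2) ℂ), 0 ≤ torusRiemannDistSq (fundamentalLatticeRep 2) u v := fun u v => by
    unfold torusRiemannDistSq; exact Finset.sum_nonneg fun _ _ => sq_nonneg _
  have hm : Measurable fun z : GaugeConfig 3 L (Matrix.specialUnitaryGroup (Fin 2) ℂ) × GaugeConfig 3 L (Matrix.specialUnitaryGroup (Fin 2) ℂ) =>
      torusRiemannDistSq (fundamentalLatticeRep 2) z.1 z.2 := continuous_torusRiemannDistSq_two.measurable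
  exact (szzWassersteinSq_sqrt_sq_le _ hm hnn ν _).trans (wilson_talagrand_T2 L β' hβ ν hfin)

end Summit.QuantumFields.YangMills.Theorems.ColdStartUniversality

end
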